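import Summits.AtomisticToContinuum.HydrodynamicLimit.Theorems.CollisionIsometryCLTCollisionalTransferLocalityDefsC
import Literature.MathematicalPhysics.KineticTheory.EvenStatTruncationBound
import Literature.MathematicalPhysics.KineticTheory.HardSphereUniformGas
import Literature.MathematicalPhysics.KineticTheory.AdmissibleCellGeometry
import Summits.AtomisticToContinuum.HydrodynamicLimit.Theorems.JParityClosureEvenStressEnskogTubeStatRegular
import HarnessLib

/-!
# [PW-b]: the `r`-independent Enskog window bound along one good orbit
(line `hemisphere-affine-slaving`, crux `CollisionalTransferLocality`, stmt-AtomisticToContinuum-9518)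

Helper file (`--supports stmt-AtomisticToContinuum-9518`; registered stub `stub_enskogWindowBound`) of the line
lead (gen 1, seat c8).  For the Enskog rate functional `e_s = enskogRate σ N 1 g Ξ^{kk} r s (Φ_s z) =
∫ₓ g(σ³ρ_r) Y(σ³ρ_r) B_r Ξ^{kk} (Φ_s z, x) dx` (`EvenCollisionTubeFunctional`) with the density cutoff
`g(a) = (min(1, 2 − 2a/η_c))₊` and the trace momentum-transfer mark `Ξ^{kk} = evenMark k k`, it proves the
deterministic window bound `|σ³ ∫_[0,τ'] e − σ³ ∫_[0,τ] e| ≤ C E₀ (τ' − τ)` along every good orbit whose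
normalised kinetic energy is capped by `E₀` and whose `r`-mollified empirical density never exceeds `2` on
`[0, t]`, with a constant `C = 16 |S²| (3K/(2π) + |Y 0|)` depending ONLY on the linear compressibility bound
`|Z(η) − 1| ≤ K η` (on `[0, η_Z] ⊇ [0, η_c]`) — NOT on the mollifier radius `r`.

* `abs_enskogCutoff_mul_contactValue_le` — STEP 1: `|g(a) Y(a)| ≤ 3K/(2π) + |Y 0|` on `[0, ∞)` (`Y = (3/2π) f_ex′`,
  `Z − 1 = η f_ex′`, `g = 0` beyond `η_c`, `0 ≤ g ≤ 1`);
* `abs_sum_sum_mul_mul_sphereMark_le`, `abs_pairFunctional_evenMark_le_mollDensity` — STEP 2 (pointwise in `x`):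
  `|B_r Ξ^{kk}(w, x)| ≤ 4|S²| ρ_r(w, x) · (N+1)⁻¹ Σᵢ b_r(xᵢ, x) ‖vᵢ‖²` (`pairFunctional_eq_double_sum`,
  `|Θ Ξ^{kk}(v, w)| ≤ 2|S²|(‖v‖² + ‖w‖²)`);
* `integral_coneKernel_right`, `integral_sum_coneKernel_mul` — `∫ₓ b_r(x₀, x) dx = 1` (symmetry of the cone
  kernel `coneKernel_comm` + `integral_coneKernel`), so `∫ₓ Σᵢ b_r(xᵢ, x) cᵢ dx = Σᵢ cᵢ`;
* `abs_enskogRate_one_evenMark_le_of_ceiling` — STEP 3: under the ceiling `ρ_r ≤ ρ_M`,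
  `|e_s(w)| ≤ C_{gY} · 4|S²| ρ_M · (N+1)⁻¹ · 2E(w)` (`norm_integral_le_of_norm_le` with the integrable majorant);
* `abs_setIntegral_Icc_sub_setIntegral_Icc_le` — STEP 4: a function integrable on the windows `[0, T]` and bounded
  by `B` on `[0, t]` has `|∫_[0,τ'] f − ∫_[0,τ] f| ≤ B (τ' − τ)` for `0 ≤ τ ≤ τ' ≤ t` (interval-integral calculus);
* `stub_enskogWindowBound` (registered) — the assembly (`integrableOn_enskogRate_flow` makes the time integrals
  honest; `σ³ ≤ 1`).
References: Chapman–Cowling (1970) Ch. 16 (Enskog's collisional transfer); Résibois–De Leener (1977) Ch. VI.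
-/

namespace Summit.AtomisticToContinuum.HydrodynamicLimit.Theorems.HemisphereAffineSlaving

open scoped BigOperators Topology Classical ENNReal InnerProductSpace
open Filter Set Function MeasureTheory
open Literature.Analysis.FluidPDE Literature.MathematicalPhysics.KineticTheory

noncomputable section

open Literature.MathematicalPhysics.KineticTheory (T3 V3)

/-! ## STEP 1: the cutoff times the contact value is bounded, uniformly in the density -/

/-- The density cutoff `g(a) = (min(1, 2 − 2a/η_c))₊` takes values in `[0, 1]`. -/
theorem enskogCutoff_mem_Icc (ηc a : ℝ) : max 0 (min 1 (2 - 2 * a / ηc)) ∈ Icc (0 : ℝ) 1 :=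
  ⟨le_max_left _ _, max_le zero_le_one (min_le_left _ _)⟩

/-- The density cutoff vanishes beyond `η_c`: `g(a) = 0` for `0 < η_c ≤ a`. -/
theorem enskogCutoff_eq_zero_of_le {ηc a : ℝ} (hηc : 0 < ηc) (ha : ηc ≤ a) :
    max 0 (min 1 (2 - 2 * a / ηc)) = 0 := by
  have h2 : (2 : ℝ) ≤ 2 * a / ηc := by
    rw [le_div_iff₀ hηc]
    nlinarith
  exact max_eq_left ((min_le_right _ _).trans (by linarith))

/-- **STEP 1.** Under the linear compressibility bound `|Z(η) − 1| ≤ K η` on `[0, η_Z]` and `0 < η_c ≤ η_Z`: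
`|g(a) Y(a)| ≤ 3K/(2π) + |Y(0)|` for every `a ≥ 0` — at `a = 0` trivially (`g 0 = 1`); for `a ≥ η_c`,
`g a = 0`; for `0 < a < η_c`, `Z(a) − 1 = a f_ex′(a)` gives `|f_ex′(a)| ≤ K`, so
`|Y(a)| = (3/2π)|f_ex′(a)| ≤ 3K/(2π)`, and `|g| ≤ 1`. -/
theorem abs_enskogCutoff_mul_contactValue_le {ηZ K ηc : ℝ} (hK : 0 ≤ K)
    (hZ : ∀ η : ℝ, 0 ≤ η → η ≤ ηZ → |hsCompressibility η - 1| ≤ K * η) (hηc : 0 < ηc)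
    (hηcZ : ηc ≤ ηZ) (a : ℝ) (ha : 0 ≤ a) :
    |max 0 (min 1 (2 - 2 * a / ηc)) * contactValue a| ≤ 3 * K / (2 * Real.pi) + |contactValue 0| := by
  have hg := enskogCutoff_mem_Icc ηc a
  have hg1 : |max 0 (min 1 (2 - 2 * a / ηc))| ≤ 1 := by
    rw [abs_of_nonneg hg.1]
    exact hg.2
  have hK' : 0 ≤ 3 * K / (2 * Real.pi) := by positivity
  rw [abs_mul]
  rcases ha.eq_or_lt with h0 | hpos
  · subst h0
    calc |max 0 (min 1 (2 - 2 * 0 / ηc))| * |contactValue 0| ≤ 1 * |contactValue 0| :=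
          mul_le_mul_of_nonneg_right hg1 (abs_nonneg _)
      _ ≤ 3 * K / (2 * Real.pi) + |contactValue 0| := by linarith [abs_nonneg (contactValue 0)]
  · by_cases hc : ηc ≤ a
    · rw [enskogCutoff_eq_zero_of_le hηc hc, abs_zero, zero_mul]
      positivity
    · push Not at hc
      have hZa := hZ a ha (hc.le.trans hηcZ)
      have hder : |deriv hsExcessFreeEnergy a| ≤ K := by
        unfold hsCompressibility at hZa
        rw [add_sub_cancel_left, abs_mul, abs_of_pos hpos, mul_comm K a] at hZa
        exact le_of_mul_le_mul_left hZa hpos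
      have hY : |contactValue a| ≤ 3 * K / (2 * Real.pi) := by
        unfold contactValue
        rw [abs_mul, abs_of_pos (by positivity : (0 : ℝ) < 3 / (2 * Real.pi))]
        calc 3 / (2 * Real.pi) * |deriv hsExcessFreeEnergy a| ≤ 3 / (2 * Real.pi) * K :=
              mul_le_mul_of_nonneg_left hder (by positivity)
          _ = 3 * K / (2 * Real.pi) := by ring
      calc |max 0 (min 1 (2 - 2 * a / ηc))| * |contactValue a| ≤ 1 * (3 * K / (2 * Real.pi)) :=
            mul_le_mul hg1 hY (abs_nonneg _) zero_le_one
        _ ≤ 3 * K / (2 * Real.pi) + |contactValue 0| := by linarith [abs_nonneg (contactValue 0)]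

/-! ## STEP 2: the pair functional of the trace mark, pointwise in the base point -/

/-- A double sum `Σᵢ Σⱼ bᵢ bⱼ Θᵢⱼ` with nonnegative weights and `|Θᵢⱼ| ≤ 2S(eᵢ + eⱼ)` is bounded by
`4S (Σⱼ bⱼ)(Σᵢ bᵢ eᵢ)`. -/
theorem abs_sum_sum_mul_mul_sphereMark_le {n : ℕ} {b e : Fin n → ℝ} {Θ : Fin n → Fin n → ℝ} {S : ℝ}
    (hb : ∀ i, 0 ≤ b i) (hΘ : ∀ i j, |Θ i j| ≤ 2 * S * (e i + e j)) :
    |∑ i, ∑ j, b i * b j * Θ i j| ≤ 4 * S * (∑ j, b j) * ∑ i, b i * e i := by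
  calc |∑ i, ∑ j, b i * b j * Θ i j| ≤ ∑ i, |∑ j, b i * b j * Θ i j| := Finset.abs_sum_le_sum_abs _ _
    _ ≤ ∑ i, ∑ j, |b i * b j * Θ i j| :=
        Finset.sum_le_sum fun i _ => Finset.abs_sum_le_sum_abs _ _
    _ ≤ ∑ i, ∑ j, b i * b j * (2 * S * (e i + e j)) := by
        refine Finset.sum_le_sum fun i _ => Finset.sum_le_sum fun j _ => ?_
        rw [abs_mul, abs_of_nonneg (mul_nonneg (hb i) (hb j))]
        exact mul_le_mul_of_nonneg_left (hΘ i j) (mul_nonneg (hb i) (hb j))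
    _ = 2 * S * ((∑ i, b i * e i) * (∑ j, b j) + (∑ i, b i) * (∑ j, b j * e j)) := by
        rw [Finset.sum_mul_sum, Finset.sum_mul_sum, ← Finset.sum_add_distrib, Finset.mul_sum]
        refine Finset.sum_congr rfl fun i _ => ?_
        rw [← Finset.sum_add_distrib, Finset.mul_sum]
        refine Finset.sum_congr rfl fun j _ => ?_
        ring
    _ = 4 * S * (∑ j, b j) * ∑ i, b i * e i := by ring

/-- **STEP 2 (pointwise).** For the trace mark `Ξ^{kk}` and `r > 0`:
`|B_r Ξ^{kk}(w, x)| ≤ 4|S²| · ρ_r(w, x) · (N+1)⁻¹ Σᵢ b_r(xᵢ, x) ‖vᵢ‖²` — the double-sum form of the pair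
functional (`pairFunctional_eq_double_sum`), `b_r ≥ 0`, `|Θ Ξ^{kk}(v, w)| ≤ 2|S²|(‖v‖² + ‖w‖²)`
(`abs_sphereMark_evenMark_le'`) and `ρ_r(w, x) = (N+1)⁻¹ Σⱼ b_r(xⱼ, x)` (`mollDensity_eq_avg`). -/
theorem abs_pairFunctional_evenMark_le_mollDensity {N : ℕ} (k : Fin 3) {r : ℝ} (hr : 0 < r)
    (w : Cfg N) (x : T3) :
    |pairFunctional r (evenMark k k) w x| ≤
      4 * (sphereMeasure : Measure (Metric.sphere (0 : V3) 1)).real univ * mollDensity r w x *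
        (((N + 1 : ℕ) : ℝ)⁻¹ * ∑ i, coneKernel r (w i).1 x * ‖(w i).2‖ ^ 2) := by
  have hn0 : 0 ≤ ((N + 1 : ℕ) : ℝ)⁻¹ := by positivity
  have hb : ∀ i : Fin (N + 1), 0 ≤ coneKernel r (w i).1 x := fun i => (coneKernel_nonneg_le hr (w i).1 x).1
  have hΘ : ∀ i j : Fin (N + 1), |sphereMark (evenMark k k) (w i).2 (w j).2| ≤
      2 * (sphereMeasure : Measure (Metric.sphere (0 : V3) 1)).real univ * (‖(w i).2‖ ^ 2 + ‖(w j).2‖ ^ 2) := by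
    intro i j
    have h := abs_sphereMark_evenMark_le' k k (w i).2 (w j).2
    rwa [zero_add] at h
  have hsum := abs_sum_sum_mul_mul_sphereMark_le (b := fun i => coneKernel r (w i).1 x) (e := fun i => ‖(w i).2‖ ^ 2)
    (Θ := fun i j => sphereMark (evenMark k k) (w i).2 (w j).2) hb hΘ
  rw [pairFunctional_eq_double_sum, mollDensity_eq_avg, abs_mul, abs_of_nonneg (mul_nonneg hn0 hn0)]
  calc ((N + 1 : ℕ) : ℝ)⁻¹ * ((N + 1 : ℕ) : ℝ)⁻¹ *
        |∑ i, ∑ j, coneKernel r (w i).1 x * coneKernel r (w j).1 x * sphereMark (evenMark k k) (w i).2 (w j).2|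
      ≤ ((N + 1 : ℕ) : ℝ)⁻¹ * ((N + 1 : ℕ) : ℝ)⁻¹ *
          (4 * (sphereMeasure : Measure (Metric.sphere (0 : V3) 1)).real univ *
            (∑ j, coneKernel r (w j).1 x) * ∑ i, coneKernel r (w i).1 x * ‖(w i).2‖ ^ 2) :=
        mul_le_mul_of_nonneg_left hsum (mul_nonneg hn0 hn0)
    _ = _ := by ring

/-! ## The cone kernel has unit mass in its second slot -/

/-- `∫ₓ b_r(x₀, x) dx = 1` for `0 < r < 1/2` (`integral_coneKernel` after symmetrisation, `coneKernel_comm`). -/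
theorem integral_coneKernel_right {r : ℝ} (hr : 0 < r) (hr2 : r < 1 / 2) (x₀ : T3) :
    ∫ x, coneKernel r x₀ x = 1 := by
  simp_rw [coneKernel_comm r x₀]
  exact integral_coneKernel hr hr2 x₀

/-- `x ↦ b_r(x₀, x)` is integrable on `𝕋³` (`0 < r < 1/2`; its integral is `1 ≠ 0`). -/
theorem integrable_coneKernel_right {r : ℝ} (hr : 0 < r) (hr2 : r < 1 / 2) (x₀ : T3) :
    Integrable fun x => coneKernel r x₀ x :=
  Integrable.of_integral_ne_zero (by rw [integral_coneKernel_right hr hr2 x₀]; exact one_ne_zero)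

/-- `∫ₓ Σᵢ b_r(xᵢ, x) cᵢ dx = Σᵢ cᵢ` for every configuration and every family of coefficients
(`0 < r < 1/2`). -/
theorem integral_sum_coneKernel_mul {N : ℕ} {r : ℝ} (hr : 0 < r) (hr2 : r < 1 / 2) (w : Cfg N)
    (c : Fin (N + 1) → ℝ) :
    ∫ x : T3, ∑ i, coneKernel r (w i).1 x * c i = ∑ i, c i := by
  rw [integral_finsetSum _ fun i _ => (integrable_coneKernel_right hr hr2 (w i).1).mul_const (c i)]
  refine Finset.sum_congr rfl fun i _ => ?_
  rw [integral_mul_const, integral_coneKernel_right hr hr2, one_mul]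

/-! ## STEP 3: the Enskog rate of one configuration under the mollified ceiling -/

/-- **STEP 3.** For `σ ≥ 0`, `0 < r < 1/2`, a weight `g` with `|g(a) Y(a)| ≤ C_{gY}` on `[0, ∞)` and a
configuration `w` whose `r`-mollified density is `≤ ρ_M` everywhere:
`|enskogRate σ N 1 g Ξ^{kk} r s w| ≤ C_{gY} · (4|S²| ρ_M) · ((N+1)⁻¹ · 2E(w))` — pointwise the integrand is
dominated by `C_{gY} · 4|S²| ρ_M · (N+1)⁻¹ Σᵢ b_r(xᵢ, x)‖vᵢ‖²`, whose integral is `C_{gY} 4|S²| ρ_M (N+1)⁻¹ Σᵢ ‖vᵢ‖²`.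
The constant does not involve `r`. -/
theorem abs_enskogRate_one_evenMark_le_of_ceiling {σ : ℝ} (hσ : 0 ≤ σ) {N : ℕ} (k : Fin 3) {g : ℝ → ℝ}
    {CgY : ℝ} (hCgY : 0 ≤ CgY) (hgY : ∀ a, 0 ≤ a → |g a * contactValue a| ≤ CgY) {r : ℝ} (hr : 0 < r)
    (hr2 : r < 1 / 2) {ρM : ℝ} (w : Cfg N) (hceil : ∀ x : T3, mollDensity r w x ≤ ρM) (s : ℝ) :
    |enskogRate σ N (fun _ : ℝ × T3 => (1 : ℝ)) g (evenMark k k) r s w| ≤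
      CgY * (4 * (sphereMeasure : Measure (Metric.sphere (0 : V3) 1)).real univ * ρM) *
        (((N + 1 : ℕ) : ℝ)⁻¹ * (2 * configEnergy w)) := by
  set S : ℝ := (sphereMeasure : Measure (Metric.sphere (0 : V3) 1)).real univ with hS
  have hS0 : 0 ≤ S := measureReal_nonneg
  have hn0 : 0 ≤ ((N + 1 : ℕ) : ℝ)⁻¹ := by positivity
  have hT0 : ∀ x : T3, 0 ≤ ((N + 1 : ℕ) : ℝ)⁻¹ * ∑ i, coneKernel r (w i).1 x * ‖(w i).2‖ ^ 2 := fun x =>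
    mul_nonneg hn0 (Finset.sum_nonneg fun i _ =>
      mul_nonneg (coneKernel_nonneg_le hr (w i).1 x).1 (sq_nonneg _))
  have hmaj : Integrable fun x : T3 =>
      CgY * (4 * S * ρM) * (((N + 1 : ℕ) : ℝ)⁻¹ * ∑ i, coneKernel r (w i).1 x * ‖(w i).2‖ ^ 2) := by
    refine Integrable.const_mul (Integrable.const_mul ?_ _) _
    exact integrable_finsetSum _ fun i _ => (integrable_coneKernel_right hr hr2 (w i).1).mul_const _
  have hpt : ∀ x : T3,
      ‖(1 : ℝ) * g (σ ^ 3 * mollDensity r w x) * contactValue (σ ^ 3 * mollDensity r w x) *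
          pairFunctional r (evenMark k k) w x‖ ≤
        CgY * (4 * S * ρM) * (((N + 1 : ℕ) : ℝ)⁻¹ * ∑ i, coneKernel r (w i).1 x * ‖(w i).2‖ ^ 2) := by
    intro x
    have hρ0 : 0 ≤ mollDensity r w x := mollDensity_nonneg_of_pos hr w x
    have ha : 0 ≤ σ ^ 3 * mollDensity r w x := mul_nonneg (pow_nonneg hσ 3) hρ0
    rw [Real.norm_eq_abs, one_mul, abs_mul]
    have hB := abs_pairFunctional_evenMark_le_mollDensity k hr w x
    calc |g (σ ^ 3 * mollDensity r w x) * contactValue (σ ^ 3 * mollDensity r w x)| *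
          |pairFunctional r (evenMark k k) w x|
        ≤ CgY * (4 * S * mollDensity r w x *
            (((N + 1 : ℕ) : ℝ)⁻¹ * ∑ i, coneKernel r (w i).1 x * ‖(w i).2‖ ^ 2)) :=
          mul_le_mul (hgY _ ha) hB (abs_nonneg _) hCgY
      _ ≤ CgY * (4 * S * ρM * (((N + 1 : ℕ) : ℝ)⁻¹ * ∑ i, coneKernel r (w i).1 x * ‖(w i).2‖ ^ 2)) := by
          refine mul_le_mul_of_nonneg_left ?_ hCgY
          refine mul_le_mul_of_nonneg_right ?_ (hT0 x)
          exact mul_le_mul_of_nonneg_left (hceil x) (by positivity)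
      _ = _ := by ring
  unfold enskogRate
  have h := norm_integral_le_of_norm_le hmaj (ae_of_all _ hpt)
  rw [Real.norm_eq_abs] at h
  refine h.trans_eq ?_
  rw [integral_const_mul, integral_const_mul, integral_sum_coneKernel_mul hr hr2 w]
  unfold configEnergy
  ring

/-! ## STEP 4: window calculus for a bounded, locally integrable function of time -/

/-- **STEP 4.** If `f : ℝ → ℝ` is integrable on every window `[0, T]` and `|f| ≤ B` on `[0, t]`, then for
`0 ≤ τ ≤ τ' ≤ t`: `|∫_[0,τ'] f − ∫_[0,τ] f| ≤ B (τ' − τ)` (the difference is `∫_τ^τ' f`,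
`intervalIntegral.integral_interval_sub_left`, bounded by `intervalIntegral.norm_integral_le_of_norm_le_const`). -/
theorem abs_setIntegral_Icc_sub_setIntegral_Icc_le {f : ℝ → ℝ} {t τ τ' B : ℝ} (hτ : 0 ≤ τ) (hττ' : τ ≤ τ')
    (hτ't : τ' ≤ t) (hint : ∀ T : ℝ, IntegrableOn f (Icc 0 T)) (hpt : ∀ s ∈ Icc (0 : ℝ) t, |f s| ≤ B) :
    |(∫ s in Icc 0 τ', f s) - ∫ s in Icc 0 τ, f s| ≤ B * (τ' - τ) := by
  have hii : ∀ T : ℝ, 0 ≤ T → IntervalIntegrable f volume 0 T := fun T hT =>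
    (intervalIntegrable_iff_integrableOn_Ioc_of_le hT).2 ((hint T).mono_set Ioc_subset_Icc_self)
  rw [integral_Icc_eq_integral_Ioc, integral_Icc_eq_integral_Ioc,
    ← intervalIntegral.integral_of_le (hτ.trans hττ'), ← intervalIntegral.integral_of_le hτ,
    intervalIntegral.integral_interval_sub_left (hii τ' (hτ.trans hττ')) (hii τ hτ)]
  have h := intervalIntegral.norm_integral_le_of_norm_le_const (a := τ) (b := τ') (C := B) (f := f)
    fun s hs => by
      rw [Real.norm_eq_abs]
      rw [uIoc_of_le hττ'] at hs
      exact hpt s ⟨hτ.trans hs.1.le, hs.2.trans hτ't⟩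
  rwa [Real.norm_eq_abs, abs_of_nonneg (sub_nonneg.2 hττ')] at h

/-! ## The registered stub -/

/-- **[PW-b] · the `r`-independent Enskog window bound** (registered stub `stub_enskogWindowBound` of the line
`hemisphere-affine-slaving`, verbatim).  Fix `0 < σ ≤ 1/2`, the linear bound `|Z(η) − 1| ≤ Kη` on `[0, η_Z]`
and a cutoff level `0 < η_c ≤ η_Z`.  With `C := 16 |S²| (3K/(2π) + |Y 0|)` — independent of the mollifier
radius — for every `0 < r < 1/4`, `E₀ ≥ 0`, flow family, `N`, good initial datum `z`, horizon `t > 0` with the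
energy cap `(N+1)⁻¹ E(Φ_s z) ≤ E₀` and the mollified ceiling `ρ_r(Φ_s z, ·) ≤ 2` on `[0, t]`, each `k` and
`0 ≤ τ ≤ τ' ≤ t`: `|σ³ ∫_[0,τ'] e_k − σ³ ∫_[0,τ] e_k| ≤ C E₀ (τ' − τ)` for
`e_k(s) = enskogRate σ N 1 g Ξ^{kk} r s (Φ_s z)`.  Proof: STEP 1 (`|gY| ≤ C_{gY}`), STEP 3 with `ρ_M = 2`
(`|e_k(s)| ≤ 16|S²| C_{gY} (N+1)⁻¹ E(Φ_s z) ≤ 16|S²| C_{gY} E₀` on `[0, t]`), the time integrals are honest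
(`integrableOn_enskogRate_flow`), STEP 4, and `σ³ ≤ 1`. -/
theorem stub_enskogWindowBound : ∀ (σ : ℝ), 0 < σ → σ ≤ 1 / 2 → ∀ (ηZ K ηc : ℝ), 0 < ηZ → 0 ≤ K → (∀ η : ℝ, 0 ≤ η → η ≤ ηZ → |Literature.MathematicalPhysics.KineticTheory.hsCompressibility η - 1| ≤ K * η) → 0 < ηc → ηc ≤ ηZ → ∃ C : ℝ, 0 ≤ C ∧ ∀ (r E₀ : ℝ), 0 < r → r < 1 / 4 → 0 ≤ E₀ → ∀ (Φ : Flows σ) (N : ℕ) (z : Cfg N), z ∈ (Φ N).good → ∀ t : ℝ, 0 < t → (∀ s ∈ Icc 0 t, ((N : ℝ) + 1)⁻¹ * Literature.Analysis.FluidPDE.configEnergy ((Φ N).flow s z) ≤ E₀) → (∀ s ∈ Icc 0 t, ∀ x : T3, Literature.MathematicalPhysics.KineticTheory.mollDensity r ((Φ N).flow s z) x ≤ 2) → ∀ (k : Fin 3) (τ τ' : ℝ), 0 ≤ τ → τ ≤ τ' → τ' ≤ t → |σ ^ 3 * (∫ s in Icc 0 τ', Literature.MathematicalPhysics.KineticTheory.enskogRate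 σ N (fun _ : ℝ × T3 => (1 : ℝ)) (fun a : ℝ => max 0 (min 1 (2 - 2 * a / ηc))) (Literature.MathematicalPhysics.KineticTheory.evenMark k k) r s ((Φ N).flow s z)) - σ ^ 3 * (∫ s in Icc 0 τ, Literature.MathematicalPhysics.KineticTheory.enskogRate σ N (fun _ : ℝ × T3 => (1 : ℝ)) (fun a : ℝ => max 0 (min 1 (2 - 2 * a / ηc))) (Literature.MathematicalPhysics.KineticTheory.evenMark k k) r s ((Φ N).flow s z))| ≤ C * E₀ * (τ' - τ) := by
  intro σ hσ hσ2 ηZ K ηc _hηZ hK hZ hηc hηcZ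
  have hS0 : 0 ≤ (sphereMeasure : Measure (Metric.sphere (0 : V3) 1)).real univ := measureReal_nonneg
  have hCgY0 : 0 ≤ 3 * K / (2 * Real.pi) + |contactValue 0| := by positivity
  refine ⟨16 * (sphereMeasure : Measure (Metric.sphere (0 : V3) 1)).real univ *
    (3 * K / (2 * Real.pi) + |contactValue 0|), by positivity, ?_⟩
  intro r E₀ hr hr4 hE₀ Φ N z hz t _ht hcap hceil k τ τ' hτ hττ' hτ't
  have hr2 : r < 1 / 2 := by linarith
  have hgc : Continuous fun a : ℝ => max 0 (min 1 (2 - 2 * a / ηc)) := by fun_prop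
  have hgY : ∀ a, 0 ≤ a → |max 0 (min 1 (2 - 2 * a / ηc)) * contactValue a| ≤
      3 * K / (2 * Real.pi) + |contactValue 0| :=
    fun a ha => abs_enskogCutoff_mul_contactValue_le hK hZ hηc hηcZ a ha
  -- the time integrals are honest on every window `[0, T]`
  have hint : ∀ T : ℝ, IntegrableOn (fun s => enskogRate σ N (fun _ : ℝ × T3 => (1 : ℝ))
      (fun a : ℝ => max 0 (min 1 (2 - 2 * a / ηc))) (evenMark k k) r s ((Φ N).flow s z)) (Icc 0 T) :=
    fun T => integrableOn_enskogRate_flow (Φ N) hz continuous_const hgc (τ := T) (Cχ := 1)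
      (fun _ _ _ => by simp) hgY hσ.le hr
      (continuous_sphereMark_uncurry (continuous_evenMark k k)).measurable (abs_sphereMark_evenMark_le' k k)
  -- the pointwise-in-time bound on `[0, t]`
  have hpt : ∀ s ∈ Icc (0 : ℝ) t, |enskogRate σ N (fun _ : ℝ × T3 => (1 : ℝ))
      (fun a : ℝ => max 0 (min 1 (2 - 2 * a / ηc))) (evenMark k k) r s ((Φ N).flow s z)| ≤
        16 * (sphereMeasure : Measure (Metric.sphere (0 : V3) 1)).real univ *
          (3 * K / (2 * Real.pi) + |contactValue 0|) * E₀ := by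
    intro s hs
    have h1 := abs_enskogRate_one_evenMark_le_of_ceiling hσ.le k hCgY0 hgY hr hr2 ((Φ N).flow s z)
      (hceil s hs) s
    have h2 := hcap s hs
    have hcast : ((N + 1 : ℕ) : ℝ) = (N : ℝ) + 1 := by push_cast; ring
    rw [hcast] at h1
    calc _ ≤ _ := h1
      _ = 16 * (sphereMeasure : Measure (Metric.sphere (0 : V3) 1)).real univ *
            (3 * K / (2 * Real.pi) + |contactValue 0|) *
              (((N : ℝ) + 1)⁻¹ * configEnergy ((Φ N).flow s z)) := by ring
      _ ≤ _ := mul_le_mul_of_nonneg_left h2 (by positivity)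
  have hW := abs_setIntegral_Icc_sub_setIntegral_Icc_le hτ hττ' hτ't hint hpt
  have hσ3 : σ ^ 3 ≤ 1 := pow_le_one₀ hσ.le (by linarith)
  have hσ30 : 0 ≤ σ ^ 3 := by positivity
  rw [← mul_sub, abs_mul, abs_of_nonneg hσ30]
  calc σ ^ 3 * _ ≤ 1 * (16 * (sphereMeasure : Measure (Metric.sphere (0 : V3) 1)).real univ *
        (3 * K / (2 * Real.pi) + |contactValue 0|) * E₀ * (τ' - τ)) :=
        mul_le_mul hσ3 hW (abs_nonneg _) zero_le_one
    _ = _ := one_mul _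

end

end Summit.AtomisticToContinuum.HydrodynamicLimit.Theorems.HemisphereAffineSlaving
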